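import Summits.RiemannHypothesis.RiemannHypothesis.Theses.WeilWindowFlow
import Summits.RiemannHypothesis.RiemannHypothesis.Theorems.WeilWindowFlowStrictUnderRH
import Summits.RiemannHypothesis.RiemannHypothesis.Theorems.WeilWindowFlowWindowLipschitzStubSupBoundAux
import Literature.NumberTheory.LFunctions.WeilWindowSuzukiContinuityProofs
import Literature.NumberTheory.LFunctions.WeilGroundEnergyProofs

/-!
# Calibration of crux `WeilWindowFlow.DiniLeakage` (item stmt-RiemannHypothesis-1038):
# `DiniLeakage ↔ RiemannHypothesis ∧ WindowLipschitz`

Ported (def-free) from the standing disprover's workfile `Cruxes/DiniLeakage/Disproof.lean`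
(refuter-cdisprove-stmt-RiemannHypothesis-1038, cycles 1–2, where every theorem is sorry-free; its
findings 1, 2, 7) and landed by the line lead of the crux so that planners, the sibling crux
`WindowLipschitz` (item 1039) and the line skeletons can cite it from the tree.

What is proved, with `ε = weilGroundEnergy` (the bottom of Weil's form on the window `[-a, a]`):

* the additive and multiplicative (Grönwall) FENCES for a continuous function whose LOWER right
  Dini derivative obeys the crux's `η/δ/h` clause (Mathlib's
  `image_le_of_liminf_slope_right_lt_deriv_boundary` with a linear / exponential barrier);
* `DiniLeakage → ∀ a > 0, 0 < ε a` (fence from the PROVED coercive anchor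
  `exists_weilGroundEnergy_pos`, continuity `continuousAt_weilGroundEnergy` PROVED — Suzuki 2026
  Thm 1.3), hence `DiniLeakage → RiemannHypothesis` (Yoshida's criterion
  `riemannHypothesis_iff_forall_weilPositivityOn`, `weilGroundEnergy_nonneg_iff_holds`): the crux
  ALONE decides the summit;
* `DiniLeakage → WindowLipschitz` (the relative rate `K ε a` is bounded on compact ranges, and the
  additive fence integrates the lower right Dini bound);
* `RiemannHypothesis → WindowLipschitz → DiniLeakage` (under RH every bottom is strictly positive —
  `strictUnderRH_proof`, item 1043, PROVED — so `min_{[b₀,A]} ε > 0` rescales an absolute rate into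
  a relative one);
* hence **`DiniLeakage ↔ RiemannHypothesis ∧ WindowLipschitz`**: item 1038 is exactly the
  conjunction of the summit and item 1039.
-/

set_option linter.dupNamespace false

noncomputable section

open Set Filter Topology MeasureTheory

namespace Summit.RiemannHypothesis.RiemannHypothesis.Theorems.WeilWindowFlowDiniLeakage

open _root_.Literature.NumberTheory.LFunctions
open _root_.Summit.RiemannHypothesis.RiemannHypothesis.Theses

/-! ## The Dini clause in Mathlib's slope idiom, and the two fences -/

/-- The crux's clause "for arbitrarily small `h > 0`, `f a − f (a + h) ≤ h (r + η)`" gives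
`∃ᶠ z in 𝓝[>] a, slope (−f) a z < r'` for every `r' > r` (technical). -/
theorem frequently_slope_lt_of_dini {f : ℝ → ℝ} {a r : ℝ}
    (h : ∀ η δ : ℝ, 0 < η → 0 < δ → ∃ h : ℝ, 0 < h ∧ h < δ ∧ f a - f (a + h) ≤ h * (r + η))
    {r' : ℝ} (hr : r < r') : ∃ᶠ z in 𝓝[>] a, slope (fun x ↦ -f x) a z < r' := by
  rw [Filter.frequently_iff]
  intro U hU
  obtain ⟨u, hu, hsub⟩ := mem_nhdsGT_iff_exists_Ioo_subset.1 hU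
  have hδ : 0 < u - a := sub_pos.2 hu
  obtain ⟨h₁, h₁pos, h₁lt, hle⟩ := h ((r' - r) / 2) (u - a) (by linarith) hδ
  refine ⟨a + h₁, hsub ⟨by linarith, by linarith⟩, ?_⟩
  rw [slope_def_field]
  have hh : (a + h₁ - a) = h₁ := by ring
  rw [hh, div_lt_iff₀ h₁pos]
  nlinarith

/-- **Additive fence.** A function continuous on `[b, c]` whose lower right Dini slopes of `−f` are
`≤ L` at every point of `[b, c)` (in the crux's `η/δ/h` form) loses at most `L (c − b)`:
`f b − f c ≤ L (c − b)`. -/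
theorem sub_le_of_dini {f : ℝ → ℝ} {b c L : ℝ} (hbc : b ≤ c)
    (hf : ContinuousOn f (Icc b c))
    (hD : ∀ x ∈ Ico b c, ∀ η δ : ℝ, 0 < η → 0 < δ →
      ∃ h : ℝ, 0 < h ∧ h < δ ∧ f x - f (x + h) ≤ h * (L + η)) :
    f b - f c ≤ L * (c - b) := by
  have key := image_le_of_liminf_slope_right_le_deriv_boundary (f := fun x ↦ -f x)
    (a := b) (b := c) hf.neg (B := fun x ↦ -f b + L * (x - b)) (B' := fun _ ↦ L)
    (by simp) (by fun_prop)
    (fun x _ ↦ by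
      have h1 : HasDerivAt (fun x ↦ -f b + L * (x - b)) L x := by
        simpa using (((hasDerivAt_id x).sub_const b).const_mul L).const_add (-f b)
      exact h1.hasDerivWithinAt)
    (fun x hx r hr ↦ frequently_slope_lt_of_dini (hD x hx) hr) (right_mem_Icc.2 hbc)
  linarith

/-- **Multiplicative (Grönwall) fence.** A function continuous on `[b, c]` with `f b > 0` whose
lower right Dini slopes of `−f` are `≤ K · f x` at every `x ∈ [b, c)` (crux's `η/δ/h` form) obeys
`f x ≥ f b · e^{−K (x − b)}` on `[b, c]`; in particular it stays positive (no conjugate point is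
reached at a finite relative rate). -/
theorem mul_exp_le_of_dini {f : ℝ → ℝ} {b c K : ℝ} (hf : ContinuousOn f (Icc b c))
    (hb : 0 < f b)
    (hD : ∀ x ∈ Ico b c, ∀ η δ : ℝ, 0 < η → 0 < δ →
      ∃ h : ℝ, 0 < h ∧ h < δ ∧ f x - f (x + h) ≤ h * (K * f x + η)) :
    ∀ x ∈ Icc b c, f b * Real.exp (-(K * (x - b))) ≤ f x := by
  intro x hx
  have main : ∀ e : ℝ, 0 < e → f b * Real.exp (-(K + e) * (x - b)) ≤ f x := by
    intro e he
    have key := image_le_of_liminf_slope_right_lt_deriv_boundary (f := fun x ↦ -f x)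
      (f' := fun x ↦ K * f x) (a := b) (b := c) hf.neg
      (fun x hx r hr ↦ frequently_slope_lt_of_dini (hD x hx) hr)
      (B := fun x ↦ -f b * Real.exp (-(K + e) * (x - b)))
      (B' := fun x ↦ (K + e) * (f b * Real.exp (-(K + e) * (x - b))))
      (by simp)
      (fun x ↦ by
        have h1 : HasDerivAt (fun y : ℝ ↦ -(K + e) * (y - b)) (-(K + e) * 1) x :=
          ((hasDerivAt_id' x).sub_const b).const_mul (-(K + e))
        have h2 := (h1.exp).const_mul (-f b)
        simp only [mul_one] at h2
        exact h2.congr_deriv (by ring))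
      (fun x _ hxB ↦ by
        have hfx : f x = f b * Real.exp (-(K + e) * (x - b)) := by linarith
        have hpos : 0 < f x := by rw [hfx]; positivity
        rw [← hfx]
        nlinarith)
      hx
    linarith
  have hcl : IsClosed {e : ℝ | f b * Real.exp (-(K + e) * (x - b)) ≤ f x} :=
    isClosed_le (by fun_prop) continuous_const
  have hmem : (0 : ℝ) ∈ closure (Ioi (0 : ℝ)) := by simp [closure_Ioi]
  have h0 : f b * Real.exp (-(K + 0) * (x - b)) ≤ f x :=
    (hcl.closure_subset_iff.2 (fun e he ↦ main e he)) hmem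
  simpa [neg_mul] using h0

/-! ## The window bottom on compact ranges -/

/-- `ε` is continuous on every compact window range `[b, c] ⊂ (0, ∞)` (Suzuki 2026 Thm 1.3, the
PROVED `continuousAt_weilGroundEnergy`). -/
theorem continuousOn_weilGroundEnergy_Icc {b c : ℝ} (hb : 0 < b) :
    ContinuousOn weilGroundEnergy (Icc b c) :=
  fun _ hx ↦ (continuousAt_weilGroundEnergy (lt_of_lt_of_le hb hx.1)).continuousWithinAt

/-! ## The crux forces positivity of every bottom, hence RH -/

/-- **`DiniLeakage ⟹ ε(a) > 0` for every `a > 0`**: the Grönwall fence transports the PROVED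
coercive anchor `exists_weilGroundEnergy_pos` (Bombieri 2000 Thm 12) to every window. -/
theorem weilGroundEnergy_pos_of_diniLeakage (hD : WeilWindowFlow.DiniLeakage) :
    ∀ a : ℝ, 0 < a → 0 < weilGroundEnergy a := by
  obtain ⟨a₁, ha₁, hpos⟩ := exists_weilGroundEnergy_pos
  intro a ha
  by_cases hle : a ≤ a₁
  · exact hpos a ha hle
  · have hlt : a₁ ≤ a := (lt_of_not_ge hle).le
    obtain ⟨K, hK⟩ := hD a₁ a ha₁ hlt
    have h := mul_exp_le_of_dini (f := weilGroundEnergy) (K := K)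
      (continuousOn_weilGroundEnergy_Icc ha₁) (hpos a₁ ha₁ le_rfl)
      (fun x hx ↦ hK x hx.1 hx.2.le) a ⟨hlt, le_rfl⟩
    exact lt_of_lt_of_le (by have := hpos a₁ ha₁ le_rfl; positivity) h

/-- **The crux decides RH by itself**: `DiniLeakage → RiemannHypothesis` (positivity of every
bottom is Weil positivity on every window, `weilGroundEnergy_nonneg_iff_holds`; Yoshida's
criterion `riemannHypothesis_iff_forall_weilPositivityOn`). -/
theorem riemannHypothesis_of_diniLeakage (hD : WeilWindowFlow.DiniLeakage) : RiemannHypothesis :=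
  riemannHypothesis_iff_forall_weilPositivityOn.2 fun a ha ↦
    (weilGroundEnergy_nonneg_iff_holds ha).1 (weilGroundEnergy_pos_of_diniLeakage hD a ha).le

/-- Summit-level form of `riemannHypothesis_of_diniLeakage`. -/
theorem summit_of_diniLeakage (hD : WeilWindowFlow.DiniLeakage) : _root_.Summit.RiemannHypothesis :=
  _root_.Summit.RiemannHypothesis_iff.2 (riemannHypothesis_of_diniLeakage hD)

/-! ## The crux forces the sibling crux `WindowLipschitz` -/

/-- **`DiniLeakage ⟹ WindowLipschitz`** (item 1039): on `[b₀, A]` the relative rate `K ε a` is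
bounded by `|K| · max |ε|` (continuity on the compact range), and the additive fence integrates the
lower right Dini bound into `ε b − ε a ≤ L (a − b)`. -/
theorem windowLipschitz_of_diniLeakage (hD : WeilWindowFlow.DiniLeakage) :
    WeilWindowFlow.WindowLipschitz := by
  intro b₀ A hb₀ hA
  obtain ⟨K, hK⟩ := hD b₀ A hb₀ hA
  obtain ⟨C, hC⟩ := (isCompact_Icc (a := b₀) (b := A)).exists_bound_of_continuousOn
    (continuousOn_weilGroundEnergy_Icc hb₀)
  refine ⟨|K| * C, fun b a hb hba haA ↦ ?_⟩
  refine sub_le_of_dini hba (continuousOn_weilGroundEnergy_Icc (lt_of_lt_of_le hb₀ hb)) ?_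
  intro x hx η δ hη hδ
  have hxb : b₀ ≤ x := hb.trans hx.1
  have hxA : x ≤ A := hx.2.le.trans haA
  obtain ⟨h, hh, hhδ, hle⟩ := hK x hxb hxA η δ hη hδ
  refine ⟨h, hh, hhδ, hle.trans ?_⟩
  have h1 : |weilGroundEnergy x| ≤ C := by simpa [Real.norm_eq_abs] using hC x ⟨hxb, hxA⟩
  have h2 : K * weilGroundEnergy x ≤ |K| * C :=
    calc K * weilGroundEnergy x ≤ |K * weilGroundEnergy x| := le_abs_self _
      _ = |K| * |weilGroundEnergy x| := abs_mul _ _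
      _ ≤ |K| * C := by gcongr
  nlinarith

/-! ## Conversely: positivity of every bottom and `WindowLipschitz` give the crux -/

/-- **Positivity ∧ `WindowLipschitz` ⟹ `DiniLeakage`**: on `[b₀, A]` the continuous `ε` attains a
minimum `ε a₀ > 0`, and `K := max L 0 / ε a₀` turns the absolute rate `L` of `[b₀, A + 1]` into
the relative rate `K ε a` (with `h := min δ 1 / 2`). -/
theorem diniLeakage_of_pos_of_windowLipschitz (hpos : ∀ a : ℝ, 0 < a → 0 < weilGroundEnergy a)
    (hW : WeilWindowFlow.WindowLipschitz) : WeilWindowFlow.DiniLeakage := by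
  intro b₀ A hb₀ hA
  obtain ⟨L, hL⟩ := hW b₀ (A + 1) hb₀ (by linarith)
  obtain ⟨a₀, ha₀, hmin⟩ := (isCompact_Icc (a := b₀) (b := A)).exists_isMinOn
    (nonempty_Icc.2 hA) (continuousOn_weilGroundEnergy_Icc hb₀)
  have hm : 0 < weilGroundEnergy a₀ := hpos a₀ (lt_of_lt_of_le hb₀ ha₀.1)
  refine ⟨max L 0 / weilGroundEnergy a₀, fun a ha haA η δ hη hδ ↦ ?_⟩
  refine ⟨min δ 1 / 2, by positivity, by have := min_le_left δ 1; linarith, ?_⟩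
  have h1 : min δ 1 / 2 ≤ 1 / 2 := by have := min_le_right δ 1; linarith
  have hp : 0 < min δ 1 / 2 := by positivity
  have hLa := hL a (a + min δ 1 / 2) ha (by linarith) (by linarith)
  have hεa : weilGroundEnergy a₀ ≤ weilGroundEnergy a := hmin ⟨ha, haA⟩
  have hK0 : 0 ≤ max L 0 / weilGroundEnergy a₀ := by positivity
  have hLK : L ≤ max L 0 / weilGroundEnergy a₀ * weilGroundEnergy a :=
    calc L ≤ max L 0 := le_max_left _ _
      _ = max L 0 / weilGroundEnergy a₀ * weilGroundEnergy a₀ := by field_simp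
      _ ≤ max L 0 / weilGroundEnergy a₀ * weilGroundEnergy a := by gcongr
  nlinarith

/-! ## The calibration -/

/-- **THE CRUX IS EXACTLY `RH ∧ WindowLipschitz`**, unconditionally:
`DiniLeakage ↔ RiemannHypothesis ∧ WindowLipschitz` (inside this namespace the identifier
`RiemannHypothesis` denotes `Summit.RiemannHypothesis`, which is Mathlib's `RiemannHypothesis` by
`Summit.RiemannHypothesis_iff : … := Iff.rfl`; registered sub-goal of item 1038, stated verbatim). Consequences: every sufficient condition for
item 1038 proves item 1039 AND the Riemann hypothesis; the relative rate `K ε(a)` carries no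
information beyond this conjunction; a refutation of the crux is `¬RH` or `¬WindowLipschitz`. -/
theorem diniLeakage_iff_riemannHypothesis_and_windowLipschitz :
    Summit.RiemannHypothesis.RiemannHypothesis.Theses.WeilWindowFlow.DiniLeakage ↔ RiemannHypothesis ∧ Summit.RiemannHypothesis.RiemannHypothesis.Theses.WeilWindowFlow.WindowLipschitz := by
  refine ⟨fun h ↦ ⟨riemannHypothesis_of_diniLeakage h, windowLipschitz_of_diniLeakage h⟩,
    fun h ↦ diniLeakage_of_pos_of_windowLipschitz ?_ h.2⟩
  exact _root_.Summit.RiemannHypothesis.RiemannHypothesis.Theorems.strictUnderRH_proof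
    (_root_.Summit.RiemannHypothesis_iff.2 h.1)

/-- Summit-level form: `DiniLeakage ↔ Summit.RiemannHypothesis ∧ WindowLipschitz`. -/
theorem diniLeakage_iff_summit_and_windowLipschitz :
    WeilWindowFlow.DiniLeakage ↔ _root_.Summit.RiemannHypothesis ∧ WeilWindowFlow.WindowLipschitz := by
  rw [diniLeakage_iff_riemannHypothesis_and_windowLipschitz, _root_.Summit.RiemannHypothesis_iff]

/-- Under RH the crux is PURE REGULARITY: `DiniLeakage ↔ WindowLipschitz`. -/
theorem diniLeakage_iff_windowLipschitz_of_riemannHypothesis (hRH : RiemannHypothesis) :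
    WeilWindowFlow.DiniLeakage ↔ WeilWindowFlow.WindowLipschitz := by
  rw [diniLeakage_iff_riemannHypothesis_and_windowLipschitz]
  exact ⟨fun h ↦ h.2, fun h ↦ ⟨hRH, h⟩⟩

/-- Modulo the sibling crux `WindowLipschitz` (item 1039) alone, the crux is the Riemann
hypothesis. -/
theorem diniLeakage_iff_riemannHypothesis_of_windowLipschitz (hW : WeilWindowFlow.WindowLipschitz) :
    WeilWindowFlow.DiniLeakage ↔ RiemannHypothesis := by
  rw [diniLeakage_iff_riemannHypothesis_and_windowLipschitz]
  exact ⟨fun h ↦ h.1, fun h ↦ ⟨h, hW⟩⟩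

end Summit.RiemannHypothesis.RiemannHypothesis.Theorems.WeilWindowFlowDiniLeakage

end
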